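import Summits.QuantumFields.YangMills.Theorems.ColdStartUniversalityLatticeLangevinLiebRobinsonCouplingResponse
import Mathlib.Analysis.Calculus.MeanValue
import HarnessLib

/-!
# Route `ColdStartUniversality` (fixed-cut-off SZZ dynamics; LIEB–ROBINSON / LOCALITY package, file 21):
# ★★★ WILSON LOOPS AND THE MEAN PLAQUETTE ARE LIPSCHITZ IN THE COUPLING, UNIFORMLY IN THE VOLUME, ON THE STRONG-COUPLING WINDOW

Helper file (seat `ym-line-csu-p1`, g31; `--supports stmt-QuantumFields-24809`).  Sequel of file 20 for the `SU(2)` Wilson measures `μ_b` on `(ℤ/L)³`: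
* ★★ `hasDerivAt_wilson_integral` — for EVERY bounded measurable observable `H`, every coupling, every `L`: `d/db ∫H dμ_b |_(β') = −Cov_(μ_β')(H, S_W)`;
* ★★ `hasDerivAt_wilson_meanAction` — `d/db ⟨S_W⟩_(μ_b)|_(β') = −Var_(μ_β')(S_W)`; ★★★ `abs_deriv_wilson_meanAction_le` — `≤ #𝒫·C(β')` at `|β'| < 1/12`
  (volume-uniform specific heat per plaquette, `wilson_action_variance_le`);
* `couplingConstant_mono` — the constants are monotone on the window (`ρ`, `κ` decrease with `|β'|`, `κ ≤ log 108/2`);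
* ★★★ `wilson_loop_expectation_lipschitz` — for `|β₀| < 1/12` and `b₁, b₂ ∈ [−|β₀|, |β₀|]`:
  `|⟨Re tr w⟩_(μ_b₂) − ⟨Re tr w⟩_(μ_b₁)| ≤ 3|w|(1024π²|w|²/ρ₀)√108(1+12/κ₀)³/(1−e^(−κ₀/2))·|b₂ − b₁|`, the SAME constant for every `L`;
* ★★★ `wilson_meanAction_lipschitz` — `|⟨S_W⟩_(μ_b₂) − ⟨S_W⟩_(μ_b₁)| ≤ #𝒫·12(16384π²/ρ₀)√108(1+12/κ₀)³/(1−e^(−κ₀/2))·|b₂ − b₁|`: per plaquette, volume-free.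
Mean value inequality (`Convex.norm_image_sub_le_of_norm_hasDerivWithin_le`) on the derivative bounds of file 20.  THEOREMS ONLY, no definition, no sorry;
[folklore].  HONEST FRAMING: fixed cut-off, FIXED strong-coupling window; regularity in the coupling here is the classical strong-coupling picture and says
nothing about `β'_K → ∞`; `UniformColdStartMixing` (24809) is NOT restated; no crux, rung or summit statement is proved; the Yang–Mills mass gap is NOT proved.
-/

set_option autoImplicit false

noncomputable section

namespace Summit.QuantumFields.YangMills.Theorems.ColdStartUniversality.LiebRobinson

open MeasureTheory ProbabilityTheory Matrix Complex Finset Filter Set Metric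
open scoped ComplexConjugate BigOperators Matrix NNReal ENNReal Topology
open Literature.Probability.Process Literature.MathematicalPhysics.QuantumFieldTheory
open Literature.MathematicalPhysics.QuantumFieldTheory.Balaban1983to89
open Literature.MathematicalPhysics.QuantumLattice (fundamentalRep fundamentalLatticeRep continuous_fundamentalRep fundamentalRep_apply)

variable {L : ℕ} [NeZero L]

/-! ## §1. The coupling derivative of a general bounded observable; the mean action -/

/-- ★★ **Coupling derivative of any bounded measurable observable** — every coupling `β'`, every `L`:
`d/db|_(b=β') ∫ H dμ_b = −Cov_(μ_β')(H, S_W)` (first cumulant of the Gibbs tilt `μ_b = μ_(β')·e^(−(b−β')S_W)/Z`). [folklore; cite: Wilson1974, §III] -/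
theorem hasDerivAt_wilson_integral (L : ℕ) [NeZero L] (β' : ℝ)
    {H : GaugeConfig 3 L (Matrix.specialUnitaryGroup (Fin 2) ℂ) → ℝ} (hHm : Measurable H) {CH : ℝ} (hHb : ∀ x, |H x| ≤ CH) :
    HasDerivAt (fun b : ℝ => ∫ x, H x ∂(wilsonMeasure (d := 3) (L := L) (fundamentalRep (Fin 2)) b))
      (-((∫ x, H x * Literature.MathematicalPhysics.QuantumFieldTheory.wilsonAction (fundamentalRep (Fin 2)) x ∂(wilsonMeasure (d := 3) (L := L) (fundamentalRep (Fin 2)) β')) - (∫ x, H x ∂(wilsonMeasure (d := 3) (L := L) (fundamentalRep (Fin 2)) β')) * (∫ x, Literature.MathematicalPhysics.QuantumFieldTheory.wilsonAction (fundamentalRep (Fin 2)) x ∂(wilsonMeasure (d := 3) (L := L) (fundamentalRep (Fin 2)) β')))) β' := by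
  classical
  haveI := secondCountableTopology_su2
  haveI := borelSpace_config L
  set μ : Measure (GaugeConfig 3 L (Matrix.specialUnitaryGroup (Fin 2) ℂ)) := (wilsonMeasure (d := 3) (L := L) (fundamentalRep (Fin 2)) β') with hμ
  haveI : IsProbabilityMeasure μ :=
    isProbabilityMeasure_wilsonMeasure (d := 3) (L := L) (fundamentalRep (Fin 2)) (continuous_fundamentalRep (Fin 2)) β'
  have hρ := continuous_fundamentalRep (Fin 2)
  obtain ⟨B, hB⟩ := Literature.MathematicalPhysics.QuantumFieldTheory.exists_abs_wilsonAction_le (d := 3) (L := L) (fundamentalRep (Fin 2)) hρ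
  have hSm := Literature.MathematicalPhysics.QuantumFieldTheory.measurable_wilsonAction (d := 3) (L := L) (G := Matrix.specialUnitaryGroup (Fin 2) ℂ) (fundamentalRep (Fin 2)) hρ
  have hXm : Measurable fun U : GaugeConfig 3 L (Matrix.specialUnitaryGroup (Fin 2) ℂ) => -Literature.MathematicalPhysics.QuantumFieldTheory.wilsonAction (fundamentalRep (Fin 2)) U := hSm.neg
  have hXb : ∀ U : GaugeConfig 3 L (Matrix.specialUnitaryGroup (Fin 2) ℂ), |-Literature.MathematicalPhysics.QuantumFieldTheory.wilsonAction (fundamentalRep (Fin 2)) U| ≤ B := fun U => by rw [abs_neg]; exact hB U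
  have hD := Literature.MathematicalPhysics.QuantumFieldTheory.ToronCumulant.hasDerivAt_integral_tilted_zero (μ := μ) hXm hHm hXb hHb
  have hfun : (fun b : ℝ => ∫ x, H x ∂(wilsonMeasure (d := 3) (L := L) (fundamentalRep (Fin 2)) b)) =
      (fun t : ℝ => ∫ x, H x ∂(μ.tilted fun U => t * (-Literature.MathematicalPhysics.QuantumFieldTheory.wilsonAction (fundamentalRep (Fin 2)) U))) ∘ (fun b : ℝ => b - β') := by
    funext b
    simp only [Function.comp_apply]
    rw [wilsonMeasure_eq_tilted_wilsonMeasure_su2 L β' b]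
  rw [hfun]
  have hsub : HasDerivAt (fun b : ℝ => b - β') 1 β' := (hasDerivAt_id β').sub_const β'
  have hcomp := HasDerivAt.comp β' (h₂ := fun t : ℝ => ∫ x, H x ∂(μ.tilted fun U => t * (-Literature.MathematicalPhysics.QuantumFieldTheory.wilsonAction (fundamentalRep (Fin 2)) U))) (by rw [sub_self]; exact hD) hsub
  rw [mul_one] at hcomp
  refine hcomp.congr_deriv ?_
  have e1 : ∫ x, H x * (-Literature.MathematicalPhysics.QuantumFieldTheory.wilsonAction (fundamentalRep (Fin 2)) x) ∂μ = -∫ x, H x * Literature.MathematicalPhysics.QuantumFieldTheory.wilsonAction (fundamentalRep (Fin 2)) x ∂μ := by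
    rw [← integral_neg]; exact integral_congr_ae (ae_of_all _ fun x => by ring)
  have e2 : ∫ x, (-Literature.MathematicalPhysics.QuantumFieldTheory.wilsonAction (fundamentalRep (Fin 2)) x) ∂μ = -∫ x, Literature.MathematicalPhysics.QuantumFieldTheory.wilsonAction (fundamentalRep (Fin 2)) x ∂μ := integral_neg _
  rw [e1, e2]
  ring

/-- ★★ **The mean action is a smooth function of the coupling with derivative minus its variance** — every coupling, every `L`:
`d/db|_(b=β') ⟨S_W⟩_(μ_b) = −Var_(μ_β')(S_W)` (`= −d²/db² log Z`, the specific heat up to sign and normalisation). [folklore] -/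
theorem hasDerivAt_wilson_meanAction (L : ℕ) [NeZero L] (β' : ℝ) :
    HasDerivAt (fun b : ℝ => ∫ x, Literature.MathematicalPhysics.QuantumFieldTheory.wilsonAction (fundamentalRep (Fin 2)) x ∂(wilsonMeasure (d := 3) (L := L) (fundamentalRep (Fin 2)) b))
      (-(∫ x, (Literature.MathematicalPhysics.QuantumFieldTheory.wilsonAction (fundamentalRep (Fin 2)) x - ∫ z, Literature.MathematicalPhysics.QuantumFieldTheory.wilsonAction (fundamentalRep (Fin 2)) z ∂(wilsonMeasure (d := 3) (L := L) (fundamentalRep (Fin 2)) β')) ^ 2 ∂(wilsonMeasure (d := 3) (L := L) (fundamentalRep (Fin 2)) β'))) β' := by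
  classical
  haveI := secondCountableTopology_su2
  haveI := borelSpace_config L
  set μ : Measure (GaugeConfig 3 L (Matrix.specialUnitaryGroup (Fin 2) ℂ)) := (wilsonMeasure (d := 3) (L := L) (fundamentalRep (Fin 2)) β') with hμ
  haveI : IsProbabilityMeasure μ :=
    isProbabilityMeasure_wilsonMeasure (d := 3) (L := L) (fundamentalRep (Fin 2)) (continuous_fundamentalRep (Fin 2)) β'
  have hρ := continuous_fundamentalRep (Fin 2)
  obtain ⟨B, hB⟩ := Literature.MathematicalPhysics.QuantumFieldTheory.exists_abs_wilsonAction_le (d := 3) (L := L) (fundamentalRep (Fin 2)) hρ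
  have hSm := Literature.MathematicalPhysics.QuantumFieldTheory.measurable_wilsonAction (d := 3) (L := L) (G := Matrix.specialUnitaryGroup (Fin 2) ℂ) (fundamentalRep (Fin 2)) hρ
  have h := hasDerivAt_wilson_integral L β' hSm hB
  refine h.congr_deriv ?_
  congr 1
  -- `Var = ∫ S·S − m·m`
  set m : ℝ := ∫ z, Literature.MathematicalPhysics.QuantumFieldTheory.wilsonAction (fundamentalRep (Fin 2)) z ∂μ with hm
  have hSi : Integrable (Literature.MathematicalPhysics.QuantumFieldTheory.wilsonAction (fundamentalRep (Fin 2))) μ :=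
    Integrable.of_bound hSm.aestronglyMeasurable B (ae_of_all _ fun U => by rw [Real.norm_eq_abs]; exact hB U)
  have hSSi : Integrable (fun x => Literature.MathematicalPhysics.QuantumFieldTheory.wilsonAction (fundamentalRep (Fin 2)) x * Literature.MathematicalPhysics.QuantumFieldTheory.wilsonAction (fundamentalRep (Fin 2)) x) μ :=
    Integrable.of_bound (hSm.mul hSm).aestronglyMeasurable (B * B) (ae_of_all _ fun U => by
      rw [Real.norm_eq_abs, abs_mul]; exact mul_le_mul (hB U) (hB U) (abs_nonneg _) ((abs_nonneg _).trans (hB U)))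
  have e : ∀ x : GaugeConfig 3 L (Matrix.specialUnitaryGroup (Fin 2) ℂ), (Literature.MathematicalPhysics.QuantumFieldTheory.wilsonAction (fundamentalRep (Fin 2)) x - m) ^ 2 = Literature.MathematicalPhysics.QuantumFieldTheory.wilsonAction (fundamentalRep (Fin 2)) x * Literature.MathematicalPhysics.QuantumFieldTheory.wilsonAction (fundamentalRep (Fin 2)) x - 2 * m * Literature.MathematicalPhysics.QuantumFieldTheory.wilsonAction (fundamentalRep (Fin 2)) x + m ^ 2 :=
    fun x => by ring
  have i2 : Integrable (fun x => 2 * m * Literature.MathematicalPhysics.QuantumFieldTheory.wilsonAction (fundamentalRep (Fin 2)) x) μ := hSi.const_mul (2 * m)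
  have i1 : Integrable (fun x => Literature.MathematicalPhysics.QuantumFieldTheory.wilsonAction (fundamentalRep (Fin 2)) x * Literature.MathematicalPhysics.QuantumFieldTheory.wilsonAction (fundamentalRep (Fin 2)) x - 2 * m * Literature.MathematicalPhysics.QuantumFieldTheory.wilsonAction (fundamentalRep (Fin 2)) x) μ := hSSi.sub i2
  rw [integral_congr_ae (ae_of_all _ e), integral_add i1 (integrable_const (m ^ 2)), integral_sub hSSi i2,
    MeasureTheory.integral_const_mul, MeasureTheory.integral_const, smul_eq_mul, probReal_univ, one_mul, ← hm]
  ring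

/-- ★★★ **VOLUME-UNIFORM SPECIFIC-HEAT BOUND**: at `|β'| < 1/12`, for every `L`,
`|d/db ⟨S_W⟩_(μ_b)|_(b=β')| = Var_(μ_β')(S_W) ≤ #𝒫 · 12·(16384π²/ρ)·e^κ·(1+12/κ)³/(1−e^(−κ/2))` — the mean plaquette `⟨S_W⟩/#𝒫` responds to the coupling at
a rate bounded independently of the volume; no first-order signature in the strong-coupling window, kernel-checked for every finite torus (the
infinite-volume / continuum questions are untouched).  [folklore] -/
theorem abs_deriv_wilson_meanAction_le (L : ℕ) [NeZero L] (β' : ℝ) (hβ : |β'| < 1 / 12) :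
    |deriv (fun b : ℝ => ∫ x, Literature.MathematicalPhysics.QuantumFieldTheory.wilsonAction (fundamentalRep (Fin 2)) x ∂(wilsonMeasure (d := 3) (L := L) (fundamentalRep (Fin 2)) b)) β'| ≤ (Fintype.card (Plaquette 3 L) : ℝ) * (3 * (4 : ℝ) * ((1024 * Real.pi ^ 2 * (4 : ℝ) ^ 2 / (1 - 12 * |β'|)) * Real.exp ((1 - 12 * |β'|) * Real.log 108 / (2 * ((1300 + 4 * Real.sqrt 2) * |β'| + (1 - 12 * |β'|))))) * ((1 + 12 / ((1 - 12 * |β'|) * Real.log 108 / (2 * ((1300 + 4 * Real.sqrt 2) * |β'| + (1 - 12 * |β'|))))) ^ 3 / (1 - Real.exp (-(((1 - 12 * |β'|) * Real.log 108 / (2 * ((1300 + 4 * Real.sqrt 2) * |β'| + (1 - 12 * |β'|)))) / 2))))) := by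
  rw [(hasDerivAt_wilson_meanAction L β').deriv, abs_neg, abs_of_nonneg (integral_nonneg fun x => sq_nonneg _)]
  exact wilson_action_variance_le L β' hβ


/-! ## §2. Uniform Lipschitz continuity in the coupling on the strong-coupling window -/

omit [NeZero L] in
/-- **Monotonicity of the constants on the window.**  For `|x| ≤ |β₀| < 1/12` and `a ≥ 0`:
`(a/ρ_x)·e^(κ_x)·(1+12/κ_x)³/(1−e^(−κ_x/2)) ≤ (a/ρ_(β₀))·√108·(1+12/κ_(β₀))³/(1−e^(−κ_(β₀)/2))`
(`ρ` decreases, `κ` decreases and `κ ≤ log 108/2` along `|x| ↑`). [folklore] -/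
theorem couplingConstant_mono {x β₀ a : ℝ} (hx : |x| ≤ |β₀|) (hβ₀ : |β₀| < 1 / 12) (ha : 0 ≤ a) :
    a / (1 - 12 * |x|) * Real.exp ((1 - 12 * |x|) * Real.log 108 / (2 * ((1300 + 4 * Real.sqrt 2) * |x| + (1 - 12 * |x|)))) * ((1 + 12 / ((1 - 12 * |x|) * Real.log 108 / (2 * ((1300 + 4 * Real.sqrt 2) * |x| + (1 - 12 * |x|))))) ^ 3 / (1 - Real.exp (-(((1 - 12 * |x|) * Real.log 108 / (2 * ((1300 + 4 * Real.sqrt 2) * |x| + (1 - 12 * |x|)))) / 2)))) ≤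
      a / (1 - 12 * |β₀|) * Real.exp (Real.log 108 / 2) * ((1 + 12 / ((1 - 12 * |β₀|) * Real.log 108 / (2 * ((1300 + 4 * Real.sqrt 2) * |β₀| + (1 - 12 * |β₀|))))) ^ 3 / (1 - Real.exp (-(((1 - 12 * |β₀|) * Real.log 108 / (2 * ((1300 + 4 * Real.sqrt 2) * |β₀| + (1 - 12 * |β₀|)))) / 2)))) := by
  have hlog : 0 < Real.log 108 := Real.log_pos (by norm_num)
  have hax : 0 ≤ |x| := abs_nonneg x
  have hρ0 : 0 < (1 - 12 * |β₀|) := by linarith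
  have hρx : (1 - 12 * |β₀|) ≤ (1 - 12 * |x|) := by linarith
  have hρx0 : 0 < (1 - 12 * |x|) := by linarith
  have hl0 : 0 ≤ (1300 + 4 * Real.sqrt 2) * |x| := by positivity
  have hlx : (1300 + 4 * Real.sqrt 2) * |x| ≤ (1300 + 4 * Real.sqrt 2) * |β₀| := by
    have : 0 ≤ (1300 + 4 * Real.sqrt 2 : ℝ) := by positivity
    exact mul_le_mul_of_nonneg_left hx this
  have hden0 : 0 < (1300 + 4 * Real.sqrt 2) * |β₀| + (1 - 12 * |β₀|) := by linarith
  have hdenx : 0 < (1300 + 4 * Real.sqrt 2) * |x| + (1 - 12 * |x|) := by linarith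
  -- `κ₀ ≤ κ_x ≤ log 108 / 2`
  have hκ0 : 0 < ((1 - 12 * |β₀|) * Real.log 108 / (2 * ((1300 + 4 * Real.sqrt 2) * |β₀| + (1 - 12 * |β₀|)))) := by positivity
  have hκx0 : 0 < ((1 - 12 * |x|) * Real.log 108 / (2 * ((1300 + 4 * Real.sqrt 2) * |x| + (1 - 12 * |x|)))) := by positivity
  have hκ : ((1 - 12 * |β₀|) * Real.log 108 / (2 * ((1300 + 4 * Real.sqrt 2) * |β₀| + (1 - 12 * |β₀|)))) ≤ ((1 - 12 * |x|) * Real.log 108 / (2 * ((1300 + 4 * Real.sqrt 2) * |x| + (1 - 12 * |x|)))) := by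
    rw [div_le_div_iff₀ (by positivity) (by positivity)]
    have h1 : (1 - 12 * |β₀|) * (1300 + 4 * Real.sqrt 2) * |x| ≤ (1 - 12 * |x|) * (1300 + 4 * Real.sqrt 2) * |β₀| := by nlinarith
    nlinarith
  have hκle : ((1 - 12 * |x|) * Real.log 108 / (2 * ((1300 + 4 * Real.sqrt 2) * |x| + (1 - 12 * |x|)))) ≤ Real.log 108 / 2 := by
    rw [div_le_div_iff₀ (by positivity) (by norm_num)]
    nlinarith
  -- the pieces
  have h1 : a / (1 - 12 * |x|) ≤ a / (1 - 12 * |β₀|) := div_le_div_of_nonneg_left ha hρ0 hρx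
  have h2 : Real.exp ((1 - 12 * |x|) * Real.log 108 / (2 * ((1300 + 4 * Real.sqrt 2) * |x| + (1 - 12 * |x|)))) ≤ Real.exp (Real.log 108 / 2) := Real.exp_le_exp.2 hκle
  have h3 : (1 + 12 / ((1 - 12 * |x|) * Real.log 108 / (2 * ((1300 + 4 * Real.sqrt 2) * |x| + (1 - 12 * |x|))))) ^ 3 ≤ (1 + 12 / ((1 - 12 * |β₀|) * Real.log 108 / (2 * ((1300 + 4 * Real.sqrt 2) * |β₀| + (1 - 12 * |β₀|))))) ^ 3 := by
    have : 12 / ((1 - 12 * |x|) * Real.log 108 / (2 * ((1300 + 4 * Real.sqrt 2) * |x| + (1 - 12 * |x|)))) ≤ 12 / ((1 - 12 * |β₀|) * Real.log 108 / (2 * ((1300 + 4 * Real.sqrt 2) * |β₀| + (1 - 12 * |β₀|)))) := div_le_div_of_nonneg_left (by norm_num) hκ0 hκ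
    exact pow_le_pow_left₀ (by positivity) (by linarith) 3
  have hq0 : 0 < 1 - Real.exp (-(((1 - 12 * |β₀|) * Real.log 108 / (2 * ((1300 + 4 * Real.sqrt 2) * |β₀| + (1 - 12 * |β₀|)))) / 2)) := by
    have := Real.exp_lt_one_iff.2 (show -(((1 - 12 * |β₀|) * Real.log 108 / (2 * ((1300 + 4 * Real.sqrt 2) * |β₀| + (1 - 12 * |β₀|)))) / 2) < 0 by linarith); linarith
  have h4 : 1 - Real.exp (-(((1 - 12 * |β₀|) * Real.log 108 / (2 * ((1300 + 4 * Real.sqrt 2) * |β₀| + (1 - 12 * |β₀|)))) / 2)) ≤ 1 - Real.exp (-(((1 - 12 * |x|) * Real.log 108 / (2 * ((1300 + 4 * Real.sqrt 2) * |x| + (1 - 12 * |x|)))) / 2)) := by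
    have := Real.exp_le_exp.2 (show -(((1 - 12 * |x|) * Real.log 108 / (2 * ((1300 + 4 * Real.sqrt 2) * |x| + (1 - 12 * |x|)))) / 2) ≤ -(((1 - 12 * |β₀|) * Real.log 108 / (2 * ((1300 + 4 * Real.sqrt 2) * |β₀| + (1 - 12 * |β₀|)))) / 2) by linarith); linarith
  have h5 : ((1 + 12 / ((1 - 12 * |x|) * Real.log 108 / (2 * ((1300 + 4 * Real.sqrt 2) * |x| + (1 - 12 * |x|))))) ^ 3 / (1 - Real.exp (-(((1 - 12 * |x|) * Real.log 108 / (2 * ((1300 + 4 * Real.sqrt 2) * |x| + (1 - 12 * |x|)))) / 2)))) ≤ ((1 + 12 / ((1 - 12 * |β₀|) * Real.log 108 / (2 * ((1300 + 4 * Real.sqrt 2) * |β₀| + (1 - 12 * |β₀|))))) ^ 3 / (1 - Real.exp (-(((1 - 12 * |β₀|) * Real.log 108 / (2 * ((1300 + 4 * Real.sqrt 2) * |β₀| + (1 - 12 * |β₀|)))) / 2)))) :=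
    div_le_div₀ (by positivity) h3 hq0 h4
  have hG0 : 0 ≤ ((1 + 12 / ((1 - 12 * |x|) * Real.log 108 / (2 * ((1300 + 4 * Real.sqrt 2) * |x| + (1 - 12 * |x|))))) ^ 3 / (1 - Real.exp (-(((1 - 12 * |x|) * Real.log 108 / (2 * ((1300 + 4 * Real.sqrt 2) * |x| + (1 - 12 * |x|)))) / 2)))) := div_nonneg (by positivity) (hq0.le.trans h4)
  calc a / (1 - 12 * |x|) * Real.exp ((1 - 12 * |x|) * Real.log 108 / (2 * ((1300 + 4 * Real.sqrt 2) * |x| + (1 - 12 * |x|)))) * ((1 + 12 / ((1 - 12 * |x|) * Real.log 108 / (2 * ((1300 + 4 * Real.sqrt 2) * |x| + (1 - 12 * |x|))))) ^ 3 / (1 - Real.exp (-(((1 - 12 * |x|) * Real.log 108 / (2 * ((1300 + 4 * Real.sqrt 2) * |x| + (1 - 12 * |x|)))) / 2))))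
      ≤ a / (1 - 12 * |β₀|) * Real.exp (Real.log 108 / 2) * ((1 + 12 / ((1 - 12 * |x|) * Real.log 108 / (2 * ((1300 + 4 * Real.sqrt 2) * |x| + (1 - 12 * |x|))))) ^ 3 / (1 - Real.exp (-(((1 - 12 * |x|) * Real.log 108 / (2 * ((1300 + 4 * Real.sqrt 2) * |x| + (1 - 12 * |x|)))) / 2)))) :=
        mul_le_mul_of_nonneg_right (mul_le_mul h1 h2 (Real.exp_pos _).le (div_nonneg ha hρ0.le)) hG0
    _ ≤ a / (1 - 12 * |β₀|) * Real.exp (Real.log 108 / 2) * ((1 + 12 / ((1 - 12 * |β₀|) * Real.log 108 / (2 * ((1300 + 4 * Real.sqrt 2) * |β₀| + (1 - 12 * |β₀|))))) ^ 3 / (1 - Real.exp (-(((1 - 12 * |β₀|) * Real.log 108 / (2 * ((1300 + 4 * Real.sqrt 2) * |β₀| + (1 - 12 * |β₀|)))) / 2)))) :=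
        mul_le_mul_of_nonneg_left h5 (by positivity)

/-- ★★★ **Wilson loop expectations are LIPSCHITZ IN THE COUPLING, UNIFORMLY IN THE VOLUME, on every compact part of the strong-coupling window.**
For `|β₀| < 1/12`, every `L`, every non-empty loop word `w` and all `b₁, b₂ ∈ [−|β₀|, |β₀|]`:
`|⟨Re tr w⟩_(μ_b₂) − ⟨Re tr w⟩_(μ_b₁)| ≤ 3|w|·(1024π²|w|²/ρ₀)·√108·(1+12/κ₀)³/(1−e^(−κ₀/2)) · |b₂ − b₁|`, `ρ₀ = 1 − 12|β₀|`,
`κ₀ = ρ₀ log 108/(2((1300+4√2)|β₀| + ρ₀))` (mean value inequality with `hasDerivAt_wilson_loop_expectation` + `wilson_loop_action_covariance_abs_le`).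
Fixed cut-off; the Yang–Mills mass gap is NOT proved. [folklore] -/
theorem wilson_loop_expectation_lipschitz (L : ℕ) [NeZero L] (β₀ : ℝ) (hβ₀ : |β₀| < 1 / 12) (l₁ : List (Edge 3 L × Bool)) (hl₁ : l₁ ≠ [])
    {b₁ b₂ : ℝ} (hb₁ : b₁ ∈ Set.Icc (-|β₀|) |β₀|) (hb₂ : b₂ ∈ Set.Icc (-|β₀|) |β₀|) :
    let coords : GaugeConfig 3 L (Matrix.specialUnitaryGroup (Fin 2) ℂ) → (Edge 3 L × Fin 2 × Fin 2 × Bool → ℝ) :=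
      fun V q => (fun z : ℂ => if q.2.2.2 then z.im else z.re)
        ((fundamentalRep (Fin 2) (V q.1) : Matrix (Fin 2) (Fin 2) ℂ) q.2.1 q.2.2.1)
    |(∫ x, (fun y : (Edge 3 L × Fin 2 × Fin 2 × Bool → ℝ) => ((l₁.map (fun a : Edge 3 L × Bool => if a.2 then ((fun (ee : Edge 3 L) => Matrix.of fun (i j : Fin 2) => ((y (ee, i, j, false) : ℝ) : ℂ) + ((y (ee, i, j, true) : ℝ) : ℂ) * Complex.I) a.1)ᴴ else (fun (ee : Edge 3 L) => Matrix.of fun (i j : Fin 2) => ((y (ee, i, j, false) : ℝ) : ℂ) + ((y (ee, i, j, true) : ℝ) : ℂ) * Complex.I) a.1)).prod).trace.re) (coords x) ∂(wilsonMeasure (d := 3) (L := L) (fundamentalRep (Fin 2)) b₂)) -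
        ∫ x, (fun y : (Edge 3 L × Fin 2 × Fin 2 × Bool → ℝ) => ((l₁.map (fun a : Edge 3 L × Bool => if a.2 then ((fun (ee : Edge 3 L) => Matrix.of fun (i j : Fin 2) => ((y (ee, i, j, false) : ℝ) : ℂ) + ((y (ee, i, j, true) : ℝ) : ℂ) * Complex.I) a.1)ᴴ else (fun (ee : Edge 3 L) => Matrix.of fun (i j : Fin 2) => ((y (ee, i, j, false) : ℝ) : ℂ) + ((y (ee, i, j, true) : ℝ) : ℂ) * Complex.I) a.1)).prod).trace.re) (coords x) ∂(wilsonMeasure (d := 3) (L := L) (fundamentalRep (Fin 2)) b₁)| ≤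
      3 * (l₁.length : ℝ) * ((1024 * Real.pi ^ 2 * (l₁.length : ℝ) ^ 2) / (1 - 12 * |β₀|) * Real.exp (Real.log 108 / 2) * ((1 + 12 / ((1 - 12 * |β₀|) * Real.log 108 / (2 * ((1300 + 4 * Real.sqrt 2) * |β₀| + (1 - 12 * |β₀|))))) ^ 3 / (1 - Real.exp (-(((1 - 12 * |β₀|) * Real.log 108 / (2 * ((1300 + 4 * Real.sqrt 2) * |β₀| + (1 - 12 * |β₀|)))) / 2))))) * |b₂ - b₁| := by
  intro coords
  have hconv : Convex ℝ (Set.Icc (-|β₀|) |β₀|) := convex_Icc _ _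
  have hderiv : ∀ b ∈ Set.Icc (-|β₀|) |β₀|, HasDerivWithinAt (fun b : ℝ => ∫ x, (fun y : (Edge 3 L × Fin 2 × Fin 2 × Bool → ℝ) => ((l₁.map (fun a : Edge 3 L × Bool => if a.2 then ((fun (ee : Edge 3 L) => Matrix.of fun (i j : Fin 2) => ((y (ee, i, j, false) : ℝ) : ℂ) + ((y (ee, i, j, true) : ℝ) : ℂ) * Complex.I) a.1)ᴴ else (fun (ee : Edge 3 L) => Matrix.of fun (i j : Fin 2) => ((y (ee, i, j, false) : ℝ) : ℂ) + ((y (ee, i, j, true) : ℝ) : ℂ) * Complex.I) a.1)).prod).trace.re) (coords x) ∂(wilsonMeasure (d := 3) (L := L) (fundamentalRep (Fin 2)) b))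
      (-((∫ x, (fun y : (Edge 3 L × Fin 2 × Fin 2 × Bool → ℝ) => ((l₁.map (fun a : Edge 3 L × Bool => if a.2 then ((fun (ee : Edge 3 L) => Matrix.of fun (i j : Fin 2) => ((y (ee, i, j, false) : ℝ) : ℂ) + ((y (ee, i, j, true) : ℝ) : ℂ) * Complex.I) a.1)ᴴ else (fun (ee : Edge 3 L) => Matrix.of fun (i j : Fin 2) => ((y (ee, i, j, false) : ℝ) : ℂ) + ((y (ee, i, j, true) : ℝ) : ℂ) * Complex.I) a.1)).prod).trace.re) (coords x) * Literature.MathematicalPhysics.QuantumFieldTheory.wilsonAction (fundamentalRep (Fin 2)) x ∂(wilsonMeasure (d := 3) (L := L) (fundamentalRep (Fin 2)) b)) -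
        (∫ x, (fun y : (Edge 3 L × Fin 2 × Fin 2 × Bool → ℝ) => ((l₁.map (fun a : Edge 3 L × Bool => if a.2 then ((fun (ee : Edge 3 L) => Matrix.of fun (i j : Fin 2) => ((y (ee, i, j, false) : ℝ) : ℂ) + ((y (ee, i, j, true) : ℝ) : ℂ) * Complex.I) a.1)ᴴ else (fun (ee : Edge 3 L) => Matrix.of fun (i j : Fin 2) => ((y (ee, i, j, false) : ℝ) : ℂ) + ((y (ee, i, j, true) : ℝ) : ℂ) * Complex.I) a.1)).prod).trace.re) (coords x) ∂(wilsonMeasure (d := 3) (L := L) (fundamentalRep (Fin 2)) b)) * (∫ x, Literature.MathematicalPhysics.QuantumFieldTheory.wilsonAction (fundamentalRep (Fin 2)) x ∂(wilsonMeasure (d := 3) (L := L) (fundamentalRep (Fin 2)) b)))) (Set.Icc (-|β₀|) |β₀|) b :=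
    fun b _ => (hasDerivAt_wilson_loop_expectation L b l₁).hasDerivWithinAt
  have hbound : ∀ b ∈ Set.Icc (-|β₀|) |β₀|, ‖-((∫ x, (fun y : (Edge 3 L × Fin 2 × Fin 2 × Bool → ℝ) => ((l₁.map (fun a : Edge 3 L × Bool => if a.2 then ((fun (ee : Edge 3 L) => Matrix.of fun (i j : Fin 2) => ((y (ee, i, j, false) : ℝ) : ℂ) + ((y (ee, i, j, true) : ℝ) : ℂ) * Complex.I) a.1)ᴴ else (fun (ee : Edge 3 L) => Matrix.of fun (i j : Fin 2) => ((y (ee, i, j, false) : ℝ) : ℂ) + ((y (ee, i, j, true) : ℝ) : ℂ) * Complex.I) a.1)).prod).trace.re) (coords x) * Literature.MathematicalPhysics.QuantumFieldTheory.wilsonAction (fundamentalRep (Fin 2)) x ∂(wilsonMeasure (d := 3) (L := L) (fundamentalRep (Fin 2)) b)) -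
        (∫ x, (fun y : (Edge 3 L × Fin 2 × Fin 2 × Bool → ℝ) => ((l₁.map (fun a : Edge 3 L × Bool => if a.2 then ((fun (ee : Edge 3 L) => Matrix.of fun (i j : Fin 2) => ((y (ee, i, j, false) : ℝ) : ℂ) + ((y (ee, i, j, true) : ℝ) : ℂ) * Complex.I) a.1)ᴴ else (fun (ee : Edge 3 L) => Matrix.of fun (i j : Fin 2) => ((y (ee, i, j, false) : ℝ) : ℂ) + ((y (ee, i, j, true) : ℝ) : ℂ) * Complex.I) a.1)).prod).trace.re) (coords x) ∂(wilsonMeasure (d := 3) (L := L) (fundamentalRep (Fin 2)) b)) * (∫ x, Literature.MathematicalPhysics.QuantumFieldTheory.wilsonAction (fundamentalRep (Fin 2)) x ∂(wilsonMeasure (d := 3) (L := L) (fundamentalRep (Fin 2)) b)))‖ ≤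
      3 * (l₁.length : ℝ) * ((1024 * Real.pi ^ 2 * (l₁.length : ℝ) ^ 2) / (1 - 12 * |β₀|) * Real.exp (Real.log 108 / 2) * ((1 + 12 / ((1 - 12 * |β₀|) * Real.log 108 / (2 * ((1300 + 4 * Real.sqrt 2) * |β₀| + (1 - 12 * |β₀|))))) ^ 3 / (1 - Real.exp (-(((1 - 12 * |β₀|) * Real.log 108 / (2 * ((1300 + 4 * Real.sqrt 2) * |β₀| + (1 - 12 * |β₀|)))) / 2))))) := by
    intro b hb
    have hbabs : |b| ≤ |β₀| := abs_le.2 ⟨hb.1, hb.2⟩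
    have hb12 : |b| < 1 / 12 := lt_of_le_of_lt hbabs hβ₀
    rw [Real.norm_eq_abs, abs_neg]
    refine (wilson_loop_action_covariance_abs_le L b hb12 l₁ hl₁).trans ?_
    have hm := couplingConstant_mono hbabs hβ₀ (show (0 : ℝ) ≤ 1024 * Real.pi ^ 2 * (l₁.length : ℝ) ^ 2 by positivity)
    have h3 : (0 : ℝ) ≤ 3 * (l₁.length : ℝ) := by positivity
    calc 3 * (l₁.length : ℝ) * ((1024 * Real.pi ^ 2 * (l₁.length : ℝ) ^ 2 / (1 - 12 * |b|)) * Real.exp ((1 - 12 * |b|) * Real.log 108 / (2 * ((1300 + 4 * Real.sqrt 2) * |b| + (1 - 12 * |b|))))) * ((1 + 12 / ((1 - 12 * |b|) * Real.log 108 / (2 * ((1300 + 4 * Real.sqrt 2) * |b| + (1 - 12 * |b|))))) ^ 3 / (1 - Real.exp (-(((1 - 12 * |b|) * Real.log 108 / (2 * ((1300 + 4 * Real.sqrt 2) * |b| + (1 - 12 * |b|)))) / 2))))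
        = 3 * (l₁.length : ℝ) * ((1024 * Real.pi ^ 2 * (l₁.length : ℝ) ^ 2 / (1 - 12 * |b|)) * Real.exp ((1 - 12 * |b|) * Real.log 108 / (2 * ((1300 + 4 * Real.sqrt 2) * |b| + (1 - 12 * |b|)))) * ((1 + 12 / ((1 - 12 * |b|) * Real.log 108 / (2 * ((1300 + 4 * Real.sqrt 2) * |b| + (1 - 12 * |b|))))) ^ 3 / (1 - Real.exp (-(((1 - 12 * |b|) * Real.log 108 / (2 * ((1300 + 4 * Real.sqrt 2) * |b| + (1 - 12 * |b|)))) / 2))))) := by ring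
      _ ≤ 3 * (l₁.length : ℝ) * ((1024 * Real.pi ^ 2 * (l₁.length : ℝ) ^ 2) / (1 - 12 * |β₀|) * Real.exp (Real.log 108 / 2) * ((1 + 12 / ((1 - 12 * |β₀|) * Real.log 108 / (2 * ((1300 + 4 * Real.sqrt 2) * |β₀| + (1 - 12 * |β₀|))))) ^ 3 / (1 - Real.exp (-(((1 - 12 * |β₀|) * Real.log 108 / (2 * ((1300 + 4 * Real.sqrt 2) * |β₀| + (1 - 12 * |β₀|)))) / 2))))) :=
        mul_le_mul_of_nonneg_left hm h3
  have h := hconv.norm_image_sub_le_of_norm_hasDerivWithin_le hderiv hbound hb₁ hb₂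
  rw [Real.norm_eq_abs, Real.norm_eq_abs] at h
  exact h

/-- ★★★ **The mean action per plaquette is Lipschitz in the coupling, uniformly in the volume, on the window**: for `|β₀| < 1/12`, every `L`,
`b₁, b₂ ∈ [−|β₀|, |β₀|]`: `|⟨S_W⟩_(μ_b₂) − ⟨S_W⟩_(μ_b₁)| ≤ #𝒫 · 12·(16384π²/ρ₀)·√108·(1+12/κ₀)³/(1−e^(−κ₀/2)) · |b₂ − b₁|` — divide by `#𝒫 = 3L³`:
the mean plaquette moves by at most a VOLUME-INDEPENDENT constant times `|b₂ − b₁|`.  Fixed cut-off; the Yang–Mills mass gap is NOT proved. [folklore] -/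
theorem wilson_meanAction_lipschitz (L : ℕ) [NeZero L] (β₀ : ℝ) (hβ₀ : |β₀| < 1 / 12)
    {b₁ b₂ : ℝ} (hb₁ : b₁ ∈ Set.Icc (-|β₀|) |β₀|) (hb₂ : b₂ ∈ Set.Icc (-|β₀|) |β₀|) :
    |(∫ x, Literature.MathematicalPhysics.QuantumFieldTheory.wilsonAction (fundamentalRep (Fin 2)) x ∂(wilsonMeasure (d := 3) (L := L) (fundamentalRep (Fin 2)) b₂)) -
        ∫ x, Literature.MathematicalPhysics.QuantumFieldTheory.wilsonAction (fundamentalRep (Fin 2)) x ∂(wilsonMeasure (d := 3) (L := L) (fundamentalRep (Fin 2)) b₁)| ≤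
      (Fintype.card (Plaquette 3 L) : ℝ) * (3 * (4 : ℝ) * ((1024 * Real.pi ^ 2 * (4 : ℝ) ^ 2) / (1 - 12 * |β₀|) * Real.exp (Real.log 108 / 2) * ((1 + 12 / ((1 - 12 * |β₀|) * Real.log 108 / (2 * ((1300 + 4 * Real.sqrt 2) * |β₀| + (1 - 12 * |β₀|))))) ^ 3 / (1 - Real.exp (-(((1 - 12 * |β₀|) * Real.log 108 / (2 * ((1300 + 4 * Real.sqrt 2) * |β₀| + (1 - 12 * |β₀|)))) / 2)))))) * |b₂ - b₁| := by
  have hconv : Convex ℝ (Set.Icc (-|β₀|) |β₀|) := convex_Icc _ _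
  have hderiv : ∀ b ∈ Set.Icc (-|β₀|) |β₀|, HasDerivWithinAt (fun b : ℝ => ∫ x, Literature.MathematicalPhysics.QuantumFieldTheory.wilsonAction (fundamentalRep (Fin 2)) x ∂(wilsonMeasure (d := 3) (L := L) (fundamentalRep (Fin 2)) b))
      (-(∫ x, (Literature.MathematicalPhysics.QuantumFieldTheory.wilsonAction (fundamentalRep (Fin 2)) x - ∫ z, Literature.MathematicalPhysics.QuantumFieldTheory.wilsonAction (fundamentalRep (Fin 2)) z ∂(wilsonMeasure (d := 3) (L := L) (fundamentalRep (Fin 2)) b)) ^ 2 ∂(wilsonMeasure (d := 3) (L := L) (fundamentalRep (Fin 2)) b))) (Set.Icc (-|β₀|) |β₀|) b :=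
    fun b _ => (hasDerivAt_wilson_meanAction L b).hasDerivWithinAt
  have hbound : ∀ b ∈ Set.Icc (-|β₀|) |β₀|, ‖-(∫ x, (Literature.MathematicalPhysics.QuantumFieldTheory.wilsonAction (fundamentalRep (Fin 2)) x - ∫ z, Literature.MathematicalPhysics.QuantumFieldTheory.wilsonAction (fundamentalRep (Fin 2)) z ∂(wilsonMeasure (d := 3) (L := L) (fundamentalRep (Fin 2)) b)) ^ 2 ∂(wilsonMeasure (d := 3) (L := L) (fundamentalRep (Fin 2)) b))‖ ≤
      (Fintype.card (Plaquette 3 L) : ℝ) * (3 * (4 : ℝ) * ((1024 * Real.pi ^ 2 * (4 : ℝ) ^ 2) / (1 - 12 * |β₀|) * Real.exp (Real.log 108 / 2) * ((1 + 12 / ((1 - 12 * |β₀|) * Real.log 108 / (2 * ((1300 + 4 * Real.sqrt 2) * |β₀| + (1 - 12 * |β₀|))))) ^ 3 / (1 - Real.exp (-(((1 - 12 * |β₀|) * Real.log 108 / (2 * ((1300 + 4 * Real.sqrt 2) * |β₀| + (1 - 12 * |β₀|)))) / 2)))))) := by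
    intro b hb
    have hbabs : |b| ≤ |β₀| := abs_le.2 ⟨hb.1, hb.2⟩
    have hb12 : |b| < 1 / 12 := lt_of_le_of_lt hbabs hβ₀
    rw [Real.norm_eq_abs, abs_neg, abs_of_nonneg (integral_nonneg fun x => sq_nonneg _)]
    refine (wilson_action_variance_le L b hb12).trans ?_
    have hm := couplingConstant_mono hbabs hβ₀ (show (0 : ℝ) ≤ 1024 * Real.pi ^ 2 * (4 : ℝ) ^ 2 by positivity)
    have hP : (0 : ℝ) ≤ (Fintype.card (Plaquette 3 L) : ℝ) * (3 * (4 : ℝ)) := by positivity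
    calc (Fintype.card (Plaquette 3 L) : ℝ) * (3 * (4 : ℝ) * ((1024 * Real.pi ^ 2 * (4 : ℝ) ^ 2 / (1 - 12 * |b|)) * Real.exp ((1 - 12 * |b|) * Real.log 108 / (2 * ((1300 + 4 * Real.sqrt 2) * |b| + (1 - 12 * |b|))))) * ((1 + 12 / ((1 - 12 * |b|) * Real.log 108 / (2 * ((1300 + 4 * Real.sqrt 2) * |b| + (1 - 12 * |b|))))) ^ 3 / (1 - Real.exp (-(((1 - 12 * |b|) * Real.log 108 / (2 * ((1300 + 4 * Real.sqrt 2) * |b| + (1 - 12 * |b|)))) / 2)))))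
        = (Fintype.card (Plaquette 3 L) : ℝ) * (3 * (4 : ℝ)) * ((1024 * Real.pi ^ 2 * (4 : ℝ) ^ 2 / (1 - 12 * |b|)) * Real.exp ((1 - 12 * |b|) * Real.log 108 / (2 * ((1300 + 4 * Real.sqrt 2) * |b| + (1 - 12 * |b|)))) * ((1 + 12 / ((1 - 12 * |b|) * Real.log 108 / (2 * ((1300 + 4 * Real.sqrt 2) * |b| + (1 - 12 * |b|))))) ^ 3 / (1 - Real.exp (-(((1 - 12 * |b|) * Real.log 108 / (2 * ((1300 + 4 * Real.sqrt 2) * |b| + (1 - 12 * |b|)))) / 2))))) := by ring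
      _ ≤ (Fintype.card (Plaquette 3 L) : ℝ) * (3 * (4 : ℝ)) * ((1024 * Real.pi ^ 2 * (4 : ℝ) ^ 2) / (1 - 12 * |β₀|) * Real.exp (Real.log 108 / 2) * ((1 + 12 / ((1 - 12 * |β₀|) * Real.log 108 / (2 * ((1300 + 4 * Real.sqrt 2) * |β₀| + (1 - 12 * |β₀|))))) ^ 3 / (1 - Real.exp (-(((1 - 12 * |β₀|) * Real.log 108 / (2 * ((1300 + 4 * Real.sqrt 2) * |β₀| + (1 - 12 * |β₀|)))) / 2))))) :=
        mul_le_mul_of_nonneg_left hm hP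
      _ = _ := by ring
  have h := hconv.norm_image_sub_le_of_norm_hasDerivWithin_le hderiv hbound hb₁ hb₂
  rw [Real.norm_eq_abs, Real.norm_eq_abs] at h
  exact h

end Summit.QuantumFields.YangMills.Theorems.ColdStartUniversality.LiebRobinson
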